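import Mathlib
import Literature.Computability.Complexity.SignDegreeSimple

/-!
# Every `k`-bit table other than `±PARITY_k` has sign-degree `≤ k − 1` (Fourier truncation)

FRONTIER (cell pnp-ideate, ROUND-17 §2 / K3 of the sign-degree dichotomy); nothing here bears on P vs NP.

Classical fact (Aspnes–Beigel–Furst–Rudich 1994: the sign-degree of `f : {0,1}ᵏ → {±1}` is `k` iff
`f = ±χ_[k]`), in the elementary direction we need: if the `±1` table `u ↦ bsgn (P u)` is neither the
parity character `χ_univ` nor its negation, then dropping the top Fourier coefficient of `bsgn ∘ P` leaves a
degree-`≤ k−1` polynomial that still sign-represents `P` with margin `1 − |P̂(univ)| > 0`.  Ingredients, all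
proved here over `ℚ` in the notation of `Literature.Computability.Complexity.SignDegreeSimple`
(`bsgn`, `chiQ`, `SignDegLE`, `bsgn_eq_or`): character orthogonality in cube-point form
`∑_S χ_S(u) χ_S(v) = 2ᵏ·[u = v]` (`sum_chiQ_mul_chiQ`, via `∏ᵢ (1 + bsgn uᵢ · bsgn vᵢ)`), the Fourier
expansion `∑_S f̂(S) χ_S(u) = f(u)` (`fourier_expansion`), and the truncation argument
(`signDegLE_sub_one_of_not_parity`, `signDegLE_sub_one_or_parity`).  At `k = 3` this is the finite
dichotomy «every 3-bit table has sign-degree ≤ 2 or is ±XOR₃» (`three_bit_signDegLE_two_or_parity`) used to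
read `NC⁰₃-AVOID` off the `k = 3` case of the sign-degree-≤2-or-affine avoidance rung.
-/

namespace Summit.PneNP.PneNP.Theorems.SignDegParity

open Finset Literature.Computability.Complexity

variable {k : ℕ}

/-- Distinct bits have opposite signs: `bsgn a · bsgn b = −1` for `a ≠ b`. -/
theorem bsgn_mul_bsgn_of_ne {a b : Bool} (h : a ≠ b) : bsgn a * bsgn b = -1 := by
  cases a <;> cases b <;> simp_all [bsgn]

/-- `χ_S(u)·χ_S(v) = ∏_{i ∈ S} bsgn(uᵢ)·bsgn(vᵢ)`. -/
theorem chiQ_mul_chiQ (S : Finset (Fin k)) (u v : Fin k → Bool) :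
    chiQ S u * chiQ S v = ∏ i ∈ S, bsgn (u i) * bsgn (v i) := by
  unfold chiQ; rw [← Finset.prod_mul_distrib]

/-- CHARACTER ORTHOGONALITY (cube-point form): `∑_S χ_S(u)·χ_S(v) = 2ᵏ` if `u = v`, else `0`. -/
theorem sum_chiQ_mul_chiQ (u v : Fin k → Bool) :
    ∑ S : Finset (Fin k), chiQ S u * chiQ S v = if u = v then (2 : ℚ) ^ k else 0 := by
  simp_rw [chiQ_mul_chiQ]
  rw [← Finset.powerset_univ, ← Finset.prod_one_add]
  split_ifs with h
  · subst h
    have hs : ∀ b : Bool, bsgn b * bsgn b = 1 := fun b => by cases b <;> simp [bsgn]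
    simp [hs]
    norm_num
  · obtain ⟨i, hi⟩ : ∃ i, u i ≠ v i := Function.ne_iff.mp h
    exact Finset.prod_eq_zero (Finset.mem_univ i) (by rw [bsgn_mul_bsgn_of_ne hi]; norm_num)

/-- Fourier coefficient `f̂(S) = 2⁻ᵏ ∑_u f(u) χ_S(u)` of a rational-valued cube function. -/
def fhat (f : (Fin k → Bool) → ℚ) (S : Finset (Fin k)) : ℚ := (∑ u, f u * chiQ S u) / 2 ^ k

/-- FOURIER EXPANSION on the cube: `∑_S f̂(S)·χ_S(u) = f(u)`. -/
theorem fourier_expansion (f : (Fin k → Bool) → ℚ) (u : Fin k → Bool) :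
    ∑ S, fhat f S * chiQ S u = f u := by
  have h2 : (2 : ℚ) ^ k ≠ 0 := pow_ne_zero _ two_ne_zero
  have step : ∀ S : Finset (Fin k), fhat f S * chiQ S u = (∑ v, f v * (chiQ S v * chiQ S u)) / 2 ^ k := by
    intro S; unfold fhat; rw [div_mul_eq_mul_div, Finset.sum_mul]; simp_rw [mul_assoc]
  simp_rw [step]
  rw [← Finset.sum_div, Finset.sum_comm]
  simp_rw [← Finset.mul_sum, sum_chiQ_mul_chiQ]
  simp [h2]

/-- The character of ALL `k` coordinates evaluates to `±1`. -/
theorem chiQ_univ_cases (u : Fin k → Bool) : chiQ univ u = 1 ∨ chiQ univ u = -1 := by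
  unfold chiQ
  induction (univ : Finset (Fin k)) using Finset.induction_on with
  | empty => simp
  | insert a s ha ih =>
    rw [Finset.prod_insert ha]
    rcases bsgn_eq_or (u a) with h | h <;> rcases ih with h' | h' <;> simp [h, h']

/-- FOURIER TRUNCATION: a `k`-bit table whose `±1` form is neither `χ_univ` (`PARITY_k` up to the sign
convention) nor `−χ_univ` has sign-degree `≤ k − 1` — witnessed by its Fourier expansion with the top
coefficient dropped, margin `1 − |f̂(univ)| ≥ 2^{1−k}`.  [Aspnes–Beigel–Furst–Rudich 1994, easy direction] -/
theorem signDegLE_sub_one_of_not_parity (P : (Fin k → Bool) → Bool)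
    (h₁ : ¬ ∀ u, bsgn (P u) = chiQ univ u) (h₂ : ¬ ∀ u, bsgn (P u) = -chiQ univ u) :
    SignDegLE (k - 1) P := by
  classical
  set f : (Fin k → Bool) → ℚ := fun u => bsgn (P u) with hf
  -- the top coefficient is strictly inside (-1, 1)
  have ht : ∀ v, f v * chiQ univ v = 1 ∨ f v * chiQ univ v = -1 := fun v => by
    rcases bsgn_eq_or (P v) with h | h <;> rcases chiQ_univ_cases v with h' | h' <;> simp [hf, h, h']
  obtain ⟨v₁, hv₁⟩ := not_forall.mp h₁
  obtain ⟨v₂, hv₂⟩ := not_forall.mp h₂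
  have ht₁ : f v₁ * chiQ univ v₁ = -1 := by
    rcases bsgn_eq_or (P v₁) with h | h <;> rcases chiQ_univ_cases v₁ with h' | h' <;>
      simp_all
  have ht₂ : f v₂ * chiQ univ v₂ = 1 := by
    rcases bsgn_eq_or (P v₂) with h | h <;> rcases chiQ_univ_cases v₂ with h' | h' <;>
      simp_all
  have hcard : ∑ _v : Fin k → Bool, (1 : ℚ) = 2 ^ k := by simp
  have hlt : ∑ v, f v * chiQ univ v < 2 ^ k := by
    rw [← hcard]
    exact Finset.sum_lt_sum (fun v _ => by rcases ht v with h | h <;> norm_num [h])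
      ⟨v₁, Finset.mem_univ _, by rw [ht₁]; norm_num⟩
  have hgt : -(2 : ℚ) ^ k < ∑ v, f v * chiQ univ v := by
    rw [← hcard, ← Finset.sum_neg_distrib]
    exact Finset.sum_lt_sum (fun v _ => by rcases ht v with h | h <;> norm_num [h])
      ⟨v₂, Finset.mem_univ _, by rw [ht₂]; norm_num⟩
  have h2 : (0 : ℚ) < 2 ^ k := by positivity
  have habs : |fhat f univ| < 1 := by
    unfold fhat; rw [abs_div, abs_of_pos h2, div_lt_one h2, abs_lt]; exact ⟨hgt, hlt⟩
  -- the certificate: all Fourier coefficients except the top one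
  refine ⟨fun S => if S = univ then 0 else fhat f S, fun S hS => ?_, fun u => ?_⟩
  · have hle : S.card ≤ k := by simpa using S.card_le_univ
    have hSu : S = univ := Finset.eq_univ_of_card S (by rw [Fintype.card_fin]; omega)
    show (if S = univ then (0 : ℚ) else fhat f S) = 0
    rw [if_pos hSu]
  · show 0 < bsgn (P u) * ∑ S, (if S = univ then (0 : ℚ) else fhat f S) * chiQ S u
    have hsplit : ∑ S, (if S = univ then 0 else fhat f S) * chiQ S u
        = ∑ S, fhat f S * chiQ S u - fhat f univ * chiQ univ u := by
      rw [eq_sub_iff_add_eq, ← Finset.sum_erase_add _ _ (Finset.mem_univ (univ : Finset (Fin k))),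
        if_pos rfl, zero_mul, add_zero,
        ← Finset.sum_erase_add _ (fun S => fhat f S * chiQ S u) (Finset.mem_univ (univ : Finset (Fin k)))]
      congr 1
      exact Finset.sum_congr rfl fun S hS => by rw [if_neg (Finset.ne_of_mem_erase hS)]
    rw [hsplit, fourier_expansion, mul_sub]
    have hfu : bsgn (P u) = f u := rfl
    have hsq : f u * f u = 1 := by rcases bsgn_eq_or (P u) with h | h <;> simp [hf, h]
    rw [hfu, hsq]
    have hb : f u * (fhat f univ * chiQ univ u) ≤ |fhat f univ| := by
      calc f u * (fhat f univ * chiQ univ u) = fhat f univ * (f u * chiQ univ u) := by ring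
        _ ≤ |fhat f univ * (f u * chiQ univ u)| := le_abs_self _
        _ = |fhat f univ| := by rw [abs_mul]; rcases ht u with h | h <;> simp [h]
    linarith

/-- DICHOTOMY form: every `k`-bit table has sign-degree `≤ k − 1`, or its `±1` form is `χ_univ`, or it is
`−χ_univ` (the two parities of all `k` arguments). -/
theorem signDegLE_sub_one_or_parity (P : (Fin k → Bool) → Bool) :
    SignDegLE (k - 1) P ∨ (∀ u, bsgn (P u) = chiQ univ u) ∨ (∀ u, bsgn (P u) = -chiQ univ u) := by
  by_cases h₁ : ∀ u, bsgn (P u) = chiQ univ u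
  · exact Or.inr (Or.inl h₁)
  by_cases h₂ : ∀ u, bsgn (P u) = -chiQ univ u
  · exact Or.inr (Or.inr h₂)
  exact Or.inl (signDegLE_sub_one_of_not_parity P h₁ h₂)

/-- `k = 3`: every 3-bit table has sign-degree `≤ 2` or is `±XOR₃` (in `±1` form `±χ_univ`). -/
theorem three_bit_signDegLE_two_or_parity (P : (Fin 3 → Bool) → Bool) :
    SignDegLE 2 P ∨ (∀ u, bsgn (P u) = chiQ univ u) ∨ (∀ u, bsgn (P u) = -chiQ univ u) :=
  signDegLE_sub_one_or_parity P

end Summit.PneNP.PneNP.Theorems.SignDegParity
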